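import Summits.AtomisticToContinuum.Crystallization.Theorems.AperiodicFrustratedLawGap.Negative.OffAtlasCapCeilingCoordPull
import Summits.AtomisticToContinuum.Crystallization.Theorems.AperiodicFrustratedLawGap.Negative.OffAtlasCapCeilingDenseField

/-!
# Crux `AperiodicFrustratedLawGap` (stmt-AtomisticToContinuum-27623) · NEGATIVE lane — AT THE SHARPENED DIAL `r₁ = 19/20` ALL THREE DESK WITNESSES OF
# RECORD ARE EARNERS: none of (410) / (434) / (H6) floors the compression pull `compPull (19/20) (23/20) a`, `a ≥ 1/30`
# (decomp-a2c, (404′) transported line, hand-1 g58 (H8); sequel of `…CellF1cUncompressed95` (KF1c roots are `Uncompressed (19/20)`, so the F1 transported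
# floor is UNCONDITIONAL at this dial) and of the price sheets (411) `0.613` · (434) `0.24888` · (H6) `…DenseField` `0.18457`)

SCOPE.  Statements about the cap slot of (404′) `…AtlasReachTransport` as typed (every rooted hard-core `μ`); the three witnesses are NON-NASH (hand-2 g50)
and say nothing about #132's `…_nashCap` slots.  What this file decides: the three floors of record are floors for `compPull r₁` ONLY WHILE `r₁ ≤ 4/5`;
at `r₁ = 19/20` — admissible for the F1 row since `…CellF1cUncompressed95.hfloorT_KF1c_95` — every one of them is booked away, because in each the
over-binding is paid for by atoms CLOSER THAN `0.95` TO ANOTHER ATOM (kernel-decided below), i.e. by compressed payers: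
* §1 one Boolean checker `comp95 L S` («every `t ∈ S` has some `s ∈ L` with `0 < |s − t|² ≤ 90`», i.e. a distinct atom at distance `≤ √90/10 < 19/20`)
  and `far95 L` («all `|t|² ≥ 91`», i.e. the root's punctured `19/20`-ball is empty), decided for the three witness lists ((410) `W`/`W24`, (434) `WS`/`WS20`,
  (H6) `WU`/its 17 vectors with `|v|² ≤ 132`); `Σ_{v∈WU} g ≥ −19422/10000`.
* §2 readings: each root carries `Uncompressed (19/20)` ((434) `uncompressed_of_noContact`); each listed first-shell atom does NOT ((404′)
  `not_uncompressed_of_contact`) and lies within `23/20`; so (404′) `transportedDeficit_le_of_contacts` books `24·a` / `20·a` / `17·a`.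
* §3 ★★ with the tree ceiling `e⋆ ≤ −0.7175`: transported deficits `≤ 0.6825 − 24a` / `≤ 0.318 − 20a` / `≤ 0.2536 − 17a`, all `≤ 0` for `a ≥ 1/30`
  (`witnesses_capT_compPull95`); the three floor implications are FALSE for this kernel (`not_floors_transfer_compPull95`, `D = 0`).
HONEST LABELS.  Three configurations, one kernel instance; NO `D_T` certified (K2), nothing on A(η), no reach figure.  The cheapest falsifier LEFT for
`compPull (19/20)`: a `0.95`-SEPARATED over-bound root — a Tammes-13 first shell at radius `1.0` (chord `0.956`) inside a far field no denser than
`(0.971/0.95)³ ≈ 1.07×` the Lennard-Jones lattice; desk estimate of its deficit `≈ 0.05–0.08` against the true `e⋆ ≈ −0.7175`, which is BELOW the slack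
`0.069` of the tree's certified lower bound (411) `twoConeFloor ≤ e⋆` — so no floor for this dial is certifiable with the tree's `e⋆` bracket, and a K2
certificate for `compPull (19/20)` is the first one on this line NOT known in advance to be floored above `0.1`.  Imports: TREE (H5)
`…Negative.OffAtlasCapCeilingCoordPull` (hence (421), (434), (404′)) and (H6) `…Negative.OffAtlasCapCeilingDenseField`.  2 Bool checkers + `T17`; no instance /
notation / option; `decide +kernel` ×5 (no `native_decide`); 0 sorry.
-/

noncomputable section

namespace Summit.AtomisticToContinuum.Crystallization.Theorems.AperiodicFrustratedLawGap.Negative.OffAtlasCapCeilingCompPull95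

open MeasureTheory Metric Set
open scoped ENNReal BigOperators
open Literature.MathematicalPhysics.StatisticalMechanics Literature.Probability.Process
open Summit.AtomisticToContinuum.Crystallization.Theorems.ChargedEnergyGapNegative (E3 eStar)
open Summit.AtomisticToContinuum.Crystallization.Theorems.FrustratedLawDichotomySignedLedger (net)
open Summit.AtomisticToContinuum.Crystallization.Theorems.FrustratedLawDichotomyPeriodicEnergyCeilingKernel (eStar_le)
open Summit.AtomisticToContinuum.Crystallization.Theorems.FrustratedLawDichotomyAtlasReachTransport
  (Uncompressed compPull not_uncompressed_of_contact transportedDeficit_le_of_contacts)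
open Summit.AtomisticToContinuum.Crystallization.Theorems.AperiodicFrustratedLawGap.Negative.OffAtlasCapCeiling
  (W W_spec sq3 sub3 pt norm_pt dist_pt clusterMeasure isRootedHardCore_cluster gQ)
open Summit.AtomisticToContinuum.Crystallization.Theorems.AperiodicFrustratedLawGap.Negative.OffAtlasCapCeilingTwoCone (capFloor capFloor_eq)
open Summit.AtomisticToContinuum.Crystallization.Theorems.AperiodicFrustratedLawGap.Negative.OffAtlasCapCeilingTransport
  (W24 W24_subset clusterMeasure_singleton_ne_zero T24 card_T24 T24_spec pt_ne_of_pos rootEnergy_cluster_ge)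
open Summit.AtomisticToContinuum.Crystallization.Theorems.AperiodicFrustratedLawGap.Negative.OffAtlasCapCeilingTransportShell
  (WS WS_spec shellMeasure isRootedHardCore_shell uncompressed_of_noContact shellCapFloor shellCapFloor_eq)
open Summit.AtomisticToContinuum.Crystallization.Theorems.AperiodicFrustratedLawGap.Negative.OffAtlasCapCeilingCoordPull
  (WS20 WS20_subset TS card_TS TS_spec eq_of_cluster_atom eq_of_shell_atom shellMeasure_singleton_ne_zero rootEnergy_shell_ge)
open Summit.AtomisticToContinuum.Crystallization.Theorems.AperiodicFrustratedLawGap.Negative.OffAtlasCapCeilingDenseField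
  (WU WU_spec ptU_injOn denseMeasure isRootedHardCore_dense eq_of_dense_atom rootEnergy_dense denseCapFloor denseCapFloor_eq)

/-! ## §1. The checkers and the kernel decisions -/

/-- «every `t ∈ S` is COMPRESSED at `19/20` inside `L`»: some `s ∈ L` has `0 < |s − t|² ≤ 90` (a distinct atom at distance `≤ √90/10 < 19/20`). [new: bookkeeping] -/
def comp95 (L S : List (ℤ × ℤ × ℤ)) : Bool := S.all fun t => L.any fun s => decide (0 < sq3 (sub3 s t) ∧ sq3 (sub3 s t) ≤ 90)

/-- «the root is UNCOMPRESSED at `19/20`»: every `|t|² ≥ c` for a threshold `c ≥ 91` (distance `≥ √91/10 > 19/20`). [new: bookkeeping] -/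
def far95 (c : ℤ) (L : List (ℤ × ℤ × ℤ)) : Bool := L.all fun t => decide (c ≤ sq3 t)

/-- (H6)'s payers: the 17 vectors of `WU` with `|v|² ≤ 132` (within `23/20` of the root), as points of `ℝ³`. [new: witness] -/
def T17 : Finset E3 := ((WU.filter fun t => decide (sq3 t ≤ 132)).map pt).toFinset

/-- The kernel decides compression of the listed first shells and emptiness of the three punctured `19/20`-balls. [new: certificate] -/
theorem checks95 : (comp95 W W24 && comp95 WS WS20 && comp95 WU (WU.filter fun t => decide (sq3 t ≤ 132)) && far95 91 W && far95 91 WS && far95 91 WU) = true := by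
  decide +kernel

/-- (H6)'s payer list has 17 members. [new: certificate] -/
theorem length_filter132_WU : (WU.filter fun t => decide (sq3 t ≤ 132)).length = 17 := by decide +kernel

/-- The kernel sums (H6)'s 235 pair energies FROM BELOW: `Σ g ≥ −19422/10000` (value `−1.94218…`). [new: certificate] -/
theorem sum_gQ_WU_ge : -(19422 / 10000 : ℚ) ≤ (WU.map fun t => gQ (sq3 t)).sum := by decide +kernel

/-- Soundness of `comp95`. [new: bookkeeping] -/
theorem comp95_sound {L S : List (ℤ × ℤ × ℤ)} (h : comp95 L S = true) : ∀ t ∈ S, ∃ s ∈ L, 0 < sq3 (sub3 s t) ∧ sq3 (sub3 s t) ≤ 90 := by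
  simp only [comp95, List.all_eq_true, List.any_eq_true, decide_eq_true_eq] at h
  exact h

/-- Soundness of `far95`. [new: bookkeeping] -/
theorem far95_sound {c : ℤ} {L : List (ℤ × ℤ × ℤ)} (h : far95 c L = true) : ∀ t ∈ L, c ≤ sq3 t := by
  simp only [far95, List.all_eq_true, decide_eq_true_eq] at h
  exact h

/-- The six facts, unpacked. [new: certificate] -/
theorem facts95 : (∀ t ∈ W24, ∃ s ∈ W, 0 < sq3 (sub3 s t) ∧ sq3 (sub3 s t) ≤ 90) ∧ (∀ t ∈ WS20, ∃ s ∈ WS, 0 < sq3 (sub3 s t) ∧ sq3 (sub3 s t) ≤ 90) ∧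
    (∀ t ∈ (WU.filter fun t => decide (sq3 t ≤ 132)), ∃ s ∈ WU, 0 < sq3 (sub3 s t) ∧ sq3 (sub3 s t) ≤ 90) ∧
    (∀ t ∈ W, 91 ≤ sq3 t) ∧ (∀ t ∈ WS, 91 ≤ sq3 t) ∧ (∀ t ∈ WU, 91 ≤ sq3 t) := by
  have h := checks95
  simp only [Bool.and_eq_true] at h
  obtain ⟨⟨⟨⟨⟨h1, h2⟩, h3⟩, h4⟩, h5⟩, h6⟩ := h
  exact ⟨comp95_sound h1, comp95_sound h2, comp95_sound h3, fun t ht => le_trans (by norm_num) (far95_sound h4 t ht),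
    fun t ht => le_trans (by norm_num) (far95_sound h5 t ht), fun t ht => le_trans (by norm_num) (far95_sound h6 t ht)⟩

/-! ## §2. Metric readings and the three configurations under `compPull (19/20) (23/20) a` -/

/-- `|s − t|² ≤ 90 ⟹ dist (s/10) (t/10) < 19/20` (`90 < 9.5²`). [folklore] -/
theorem dist_pt_lt_95 {s t : ℤ × ℤ × ℤ} (h : sq3 (sub3 s t) ≤ 90) : dist (pt s) (pt t) < 19 / 20 := by
  rw [dist_pt]
  have h9 : Real.sqrt (sq3 (sub3 s t) : ℝ) ≤ Real.sqrt 90 := Real.sqrt_le_sqrt (by exact_mod_cast h)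
  have h95 : Real.sqrt 90 < 19 / 2 := (Real.sqrt_lt' (by norm_num)).2 (by norm_num)
  linarith

/-- `91 ≤ |t|² ⟹ 19/20 ≤ ‖t/10‖` (`9.5² ≤ 91`). [folklore] -/
theorem norm_pt_ge_95 {t : ℤ × ℤ × ℤ} (h : 91 ≤ sq3 t) : 19 / 20 ≤ ‖pt t‖ := by
  rw [norm_pt]
  have h1 : Real.sqrt ((19 / 2 : ℝ) ^ 2) ≤ Real.sqrt (sq3 t : ℝ) := Real.sqrt_le_sqrt (by
    have : (91 : ℝ) ≤ (sq3 t : ℝ) := by exact_mod_cast h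
    nlinarith)
  rw [Real.sqrt_sq (by norm_num)] at h1
  linarith

/-- `|t|² ≤ 132 ⟹ ‖t/10‖ ≤ 23/20` (`132 ≤ 11.5²`). [folklore] -/
theorem norm_pt_le_115 {t : ℤ × ℤ × ℤ} (h : sq3 t ≤ 132) : ‖pt t‖ ≤ 23 / 20 := by
  rw [norm_pt]
  have h1 : Real.sqrt (sq3 t : ℝ) ≤ Real.sqrt ((23 / 2 : ℝ) ^ 2) := Real.sqrt_le_sqrt (by
    have : (sq3 t : ℝ) ≤ 132 := by exact_mod_cast h
    nlinarith)
  rw [Real.sqrt_sq (by norm_num)] at h1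
  linarith

/-- ★ A GENERIC READING: in a rooted `7/10`-hard-core configuration whose atoms are the root and `pt '' L`, a list point with a distinct list point at
`|s − t|² ≤ 90` is COMPRESSED at `19/20`, and a root all of whose list points have `|t|² ≥ 91` is UNCOMPRESSED at `19/20`. [folklore] -/
theorem not_uncompressed95_of_near {μ : Measure E3} {L : List (ℤ × ℤ × ℤ)} (hatom : ∀ s ∈ L, μ {pt s} ≠ 0) {t : ℤ × ℤ × ℤ}
    (h : ∃ s ∈ L, 0 < sq3 (sub3 s t) ∧ sq3 (sub3 s t) ≤ 90) : ¬ Uncompressed (19 / 20) μ (pt t) := by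
  obtain ⟨s, hs, hpos, h90⟩ := h
  exact not_uncompressed_of_contact (hatom s hs) (pt_ne_of_pos hpos) (dist_pt_lt_95 h90)

/-- … and the root reading (see `not_uncompressed95_of_near`). [folklore] -/
theorem uncompressed95_root {μ : Measure E3} (hμ : IsRootedHardCore (7 / 10) μ) (h0 : μ {0} ≠ 0) {L : List (ℤ × ℤ × ℤ)}
    (hL : ∀ z : E3, μ {z} ≠ 0 → z = 0 ∨ ∃ s ∈ L, pt s = z) (hfar : ∀ t ∈ L, 91 ≤ sq3 t) : Uncompressed (19 / 20) μ 0 :=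
  uncompressed_of_noContact hμ h0 fun z hz hz0 => by
    rcases hL z hz with rfl | ⟨s, hs, rfl⟩
    · exact absurd rfl hz0
    · rw [dist_zero_right]; exact norm_pt_ge_95 (hfar s hs)

/-- ★ (410): root uncompressed at `19/20`, the 24 first-shell atoms compressed ⇒ income `≥ 24·a`, deficit `≤ E + 7/5 − 24a`. [new: negative] -/
theorem transportedDeficit_cluster_le_compPull95 {a : ℝ} (ha : 0 ≤ a) {E : ℝ} (hE : eStar ≤ E) :
    eStar - rootEnergy lennardJones clusterMeasure - net 0 (compPull (19 / 20) (23 / 20) a) clusterMeasure ≤ E + 7 / 5 - 24 * a := by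
  have h0 : Uncompressed (19 / 20) clusterMeasure 0 := uncompressed95_root isRootedHardCore_cluster
    (by rw [isRootedHardCore_cluster.measure_zero_singleton]; exact one_ne_zero) (fun z hz => eq_of_cluster_atom hz) facts95.2.2.2.1
  have hT : ∀ y ∈ T24, clusterMeasure {y} ≠ 0 ∧ ‖y‖ ≤ 23 / 20 ∧ ¬ Uncompressed (19 / 20) clusterMeasure y := by
    intro y hy
    obtain ⟨hat, hn, -⟩ := T24_spec y hy
    have hy' : y ∈ (W24.map pt).toFinset := hy
    rw [List.mem_toFinset, List.mem_map] at hy'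
    obtain ⟨t, ht, rfl⟩ := hy'
    exact ⟨hat, by linarith, not_uncompressed95_of_near (fun s hs => clusterMeasure_singleton_ne_zero hs) (facts95.1 t ht)⟩
  have h := transportedDeficit_le_of_contacts ha isRootedHardCore_cluster h0 T24 hT eStar
  rw [card_T24] at h
  have e : ((24 : ℕ) : ℝ) = 24 := by norm_num
  rw [e] at h
  linarith [rootEnergy_cluster_ge]

/-- ★ (434): root uncompressed at `19/20`, the 20 first-shell atoms compressed ⇒ income `≥ 20·a`, deficit `≤ E + 2071/2000 − 20a` — where EVERY
compression pull with `r₁ ≤ 4/5` books `0` at this root ((434) `net_compPull_shell`). [new: negative] -/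
theorem transportedDeficit_shell_le_compPull95 {a : ℝ} (ha : 0 ≤ a) {E : ℝ} (hE : eStar ≤ E) :
    eStar - rootEnergy lennardJones shellMeasure - net 0 (compPull (19 / 20) (23 / 20) a) shellMeasure ≤ E + 2071 / 2000 - 20 * a := by
  have h0 : Uncompressed (19 / 20) shellMeasure 0 := uncompressed95_root isRootedHardCore_shell
    (by rw [isRootedHardCore_shell.measure_zero_singleton]; exact one_ne_zero) (fun z hz => eq_of_shell_atom hz) facts95.2.2.2.2.1
  have hT : ∀ y ∈ TS, shellMeasure {y} ≠ 0 ∧ ‖y‖ ≤ 23 / 20 ∧ ¬ Uncompressed (19 / 20) shellMeasure y := by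
    intro y hy
    obtain ⟨hat, hn, -⟩ := TS_spec y hy
    have hy' : y ∈ (WS20.map pt).toFinset := hy
    rw [List.mem_toFinset, List.mem_map] at hy'
    obtain ⟨t, ht, rfl⟩ := hy'
    exact ⟨hat, by linarith, not_uncompressed95_of_near (fun s hs => shellMeasure_singleton_ne_zero hs) (facts95.2.1 t ht)⟩
  have h := transportedDeficit_le_of_contacts ha isRootedHardCore_shell h0 TS hT eStar
  rw [card_TS] at h
  have e : ((20 : ℕ) : ℝ) = 20 := by norm_num
  rw [e] at h
  linarith [rootEnergy_shell_ge]

/-- Witness vectors of (H6) are atoms. [folklore] -/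
theorem denseMeasure_singleton_ne_zero {t : ℤ × ℤ × ℤ} (ht : t ∈ WU) : denseMeasure {pt t} ≠ 0 := by
  refine (count_restrict_singleton_ne_zero_iff _ _).2 (Finset.mem_coe.2 ?_)
  simp only [Summit.AtomisticToContinuum.Crystallization.Theorems.AperiodicFrustratedLawGap.Negative.OffAtlasCapCeilingDenseField.dense,
    Finset.mem_insert, List.mem_toFinset, List.mem_map]
  exact Or.inr ⟨t, ht, rfl⟩

/-- (H6)'s payer set has 17 points. [new: certificate] -/
theorem card_T17 : T17.card = 17 := by
  have hnd : ((WU.filter fun t => decide (sq3 t ≤ 132)).map pt).Nodup :=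
    (WU_spec.2.2.filter _).map_on fun s hs t ht h => ptU_injOn s (List.mem_of_mem_filter hs) t (List.mem_of_mem_filter ht) h
  rw [T17, List.toFinset_card_of_nodup hnd, List.length_map, length_filter132_WU]

/-- `rootEnergy((H6) witness) ≥ −19422/20000`. [new: certificate] -/
theorem rootEnergy_dense_ge : -(19422 / 20000 : ℝ) ≤ rootEnergy lennardJones denseMeasure := by
  rw [rootEnergy_dense]
  have h : (((-(19422 / 10000)) : ℚ) : ℝ) ≤ ((((WU.map fun t => gQ (sq3 t)).sum) : ℚ) : ℝ) := Rat.cast_le.2 sum_gQ_WU_ge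
  have h' : (((-(19422 / 10000)) : ℚ) : ℝ) = -(19422 / 10000) := by push_cast; norm_num
  linarith

/-- ★ (H6): root uncompressed at `19/20`, its 17 atoms within `23/20` compressed ⇒ income `≥ 17·a`, deficit `≤ E + 19422/20000 − 17a` — where every
first-shell coordination pull and every `compPull r₁ ≤ 4/5` books `≤ 0` ((H6)). [new: negative] -/
theorem transportedDeficit_dense_le_compPull95 {a : ℝ} (ha : 0 ≤ a) {E : ℝ} (hE : eStar ≤ E) :
    eStar - rootEnergy lennardJones denseMeasure - net 0 (compPull (19 / 20) (23 / 20) a) denseMeasure ≤ E + 19422 / 20000 - 17 * a := by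
  have h0 : Uncompressed (19 / 20) denseMeasure 0 := uncompressed95_root isRootedHardCore_dense
    (by rw [isRootedHardCore_dense.measure_zero_singleton]; exact one_ne_zero) (fun z hz => eq_of_dense_atom hz) facts95.2.2.2.2.2
  have hT : ∀ y ∈ T17, denseMeasure {y} ≠ 0 ∧ ‖y‖ ≤ 23 / 20 ∧ ¬ Uncompressed (19 / 20) denseMeasure y := by
    intro y hy
    simp only [T17, List.mem_toFinset, List.mem_map] at hy
    obtain ⟨t, ht, rfl⟩ := hy
    have htW : t ∈ WU := List.mem_of_mem_filter ht
    have h132 : sq3 t ≤ 132 := of_decide_eq_true (List.mem_filter.1 ht).2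
    exact ⟨denseMeasure_singleton_ne_zero htW, norm_pt_le_115 h132,
      not_uncompressed95_of_near (fun s hs => denseMeasure_singleton_ne_zero hs) (facts95.2.2.1 t ht)⟩
  have h := transportedDeficit_le_of_contacts ha isRootedHardCore_dense h0 T17 hT eStar
  rw [card_T17] at h
  have e : ((17 : ℕ) : ℝ) = 17 := by norm_num
  rw [e] at h
  linarith [rootEnergy_dense_ge]

/-! ## §3. ★★ None of the three floors of record transfers to `compPull (19/20)` -/

/-- ★★ **ALL THREE DESK WITNESSES OF RECORD SATISFY EVERY CAP `D ≥ 0` OF `compPull (19/20) (23/20) a`, `a ≥ 1/30`** (tree ceiling `e⋆ ≤ −0.7175`: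
`0.6825 − 24a`, `0.318 − 20a`, `0.2536 − 17a` are all `≤ 0`). [new: negative] -/
theorem witnesses_capT_compPull95 {a D : ℝ} (ha : 1 / 30 ≤ a) (hD : 0 ≤ D) :
    eStar - rootEnergy lennardJones clusterMeasure - net 0 (compPull (19 / 20) (23 / 20) a) clusterMeasure ≤ D ∧
      eStar - rootEnergy lennardJones shellMeasure - net 0 (compPull (19 / 20) (23 / 20) a) shellMeasure ≤ D ∧
      eStar - rootEnergy lennardJones denseMeasure - net 0 (compPull (19 / 20) (23 / 20) a) denseMeasure ≤ D := by
  have ha0 : (0 : ℝ) ≤ a := by linarith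
  have h1 := transportedDeficit_cluster_le_compPull95 ha0 eStar_le
  have h2 := transportedDeficit_shell_le_compPull95 ha0 eStar_le
  have h3 := transportedDeficit_dense_le_compPull95 ha0 eStar_le
  exact ⟨by linarith, by linarith, by linarith⟩

/-- ★ THE THREE FLOOR IMPLICATIONS OF RECORD ARE FALSE AT THIS DIAL: neither (411)'s `capFloor` (0.613) nor (434)'s `shellCapFloor` (0.2489) nor (H6)'s
`denseCapFloor` (0.1846) is forced by the corresponding witness's cap instance for `compPull (19/20) (23/20) a`, `a ≥ 1/30` (take `D = 0`). [new: negative] -/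
theorem not_floors_transfer_compPull95 {a : ℝ} (ha : 1 / 30 ≤ a) :
    (¬ ∀ D : ℝ, eStar - rootEnergy lennardJones clusterMeasure - net 0 (compPull (19 / 20) (23 / 20) a) clusterMeasure ≤ D → capFloor ≤ D) ∧
      (¬ ∀ D : ℝ, eStar - rootEnergy lennardJones shellMeasure - net 0 (compPull (19 / 20) (23 / 20) a) shellMeasure ≤ D → shellCapFloor ≤ D) ∧
      (¬ ∀ D : ℝ, eStar - rootEnergy lennardJones denseMeasure - net 0 (compPull (19 / 20) (23 / 20) a) denseMeasure ≤ D → denseCapFloor ≤ D) := by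
  obtain ⟨h1, h2, h3⟩ := witnesses_capT_compPull95 ha le_rfl
  refine ⟨fun h => ?_, fun h => ?_, fun h => ?_⟩
  · have := h 0 h1; rw [capFloor_eq] at this; norm_num at this
  · have := h 0 h2; rw [shellCapFloor_eq] at this; norm_num at this
  · have := h 0 h3; rw [denseCapFloor_eq] at this; norm_num at this

end Summit.AtomisticToContinuum.Crystallization.Theorems.AperiodicFrustratedLawGap.Negative.OffAtlasCapCeilingCompPull95

end
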